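import Mathlib

/-!
# (CR) for log-supermodular laws with an avoidance conditioning
(blind cell PercRepro2, mine-a g39; MINE-A.md §94.0)

Let `μ : Finset V → K` be a nonnegative log-supermodular weight (`μ S * μ T ≤ μ (S ∩ T) * μ (S ∪ T)`,
the FKG lattice condition on the subset lattice), `X : Finset V` an avoided set, and `u, v` monotone
functions `Finset V → [0, 1]` (indicators of up-sets, say).  With `M h := ∑ S, μ S * h S` and the
PRINCIPAL down-set `R = {S ∣ S ∩ X = ∅}`, this file proves (`cr_avoid`)

  `M(1_R) · M(u) · M(v) ≤ M(1) · (M(1_R) · M(1_{Rᶜ} u v) + M(1_R u) · M(1_R v))`,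

i.e. for the probability law `μ / M(1)`: `Cov(u, v) ≥ P(R) · Cov(u, v ∣ R)` — the (CR) form of
MINE-A.md §93.9 / `CRForms.lean` for every FKG law and every avoidance conditioning.  Proof: fibre
the lattice by the `X`-part `A = S ∩ X`; Ahlswede–Daykin (`four_functions_theorem`) gives the FKG
inequality on every fibre (`fibre_fkg`), the Holley-type monotonicity of the fibre means in `A`
(`fm_mul_lam_le`) and the log-supermodularity of the marginal (`lam_lsm`); the marginal inequality
(`marginal_fkg`) is Ahlswede–Daykin once more, on the whole lattice of `X`-parts with the
fibre means `fm/λ` (the support of `λ` is a sublattice, and `x / 0 = 0` handles the rest).  The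
percolation cluster law is NOT log-supermodular (§94.1), so nothing about the percolation (CR) is
claimed; on a forest the cluster law is log-modular on the lattice of root subtrees, which is how
§94.0 gives (CR) there.  No definition (the fibre `{S ∣ S ∩ X = A}` is written out); one seat.
-/

namespace Summit.Ventures.PercRepro2

namespace CRFKG

open Finset
open scoped FinsetFamily

variable {V : Type*} [Fintype V] [DecidableEq V] {K : Type*} [Field K] [LinearOrder K]
  [IsStrictOrderedRing K]

/-- Meets of fibres land in the fibre of the meet. -/
lemma fib_infs_subset (X A B : Finset V) :
    (univ.filter fun S => S ∩ X = A) ⊼ (univ.filter fun S => S ∩ X = B) ⊆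
      univ.filter fun S => S ∩ X = A ∩ B := by
  intro S hS
  rw [mem_infs] at hS
  obtain ⟨S₁, h₁, S₂, h₂, rfl⟩ := hS
  rw [mem_filter] at h₁ h₂ ⊢
  refine ⟨mem_univ _, ?_⟩
  rw [inf_eq_inter, ← h₁.2, ← h₂.2]
  ext x; simp only [mem_inter]; tauto

/-- Joins of fibres land in the fibre of the join. -/
lemma fib_sups_subset (X A B : Finset V) :
    (univ.filter fun S => S ∩ X = A) ⊻ (univ.filter fun S => S ∩ X = B) ⊆
      univ.filter fun S => S ∩ X = A ∪ B := by
  intro S hS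
  rw [mem_sups] at hS
  obtain ⟨S₁, h₁, S₂, h₂, rfl⟩ := hS
  rw [mem_filter] at h₁ h₂ ⊢
  refine ⟨mem_univ _, ?_⟩
  rw [sup_eq_union, ← h₁.2, ← h₂.2]
  ext x; simp only [mem_inter, mem_union]; tauto

/-- The four functions theorem on two fibres: the `⊼`/`⊻` sums are bounded by the fibre sums of
the meet and of the join. -/
lemma four_functions_fib (X A B : Finset V) (a b c d : Finset V → K)
    (ha : ∀ S, 0 ≤ a S) (hb : ∀ S, 0 ≤ b S) (hc : ∀ S, 0 ≤ c S) (hd : ∀ S, 0 ≤ d S)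
    (h : ∀ S T, a S * b T ≤ c (S ∩ T) * d (S ∪ T)) :
    (∑ S ∈ univ.filter (fun S => S ∩ X = A), a S) *
        (∑ S ∈ univ.filter (fun S => S ∩ X = B), b S) ≤
      (∑ S ∈ univ.filter (fun S => S ∩ X = A ∩ B), c S) *
        (∑ S ∈ univ.filter (fun S => S ∩ X = A ∪ B), d S) := by
  have key := four_functions_theorem a b c d (fun S => ha S) (fun S => hb S) (fun S => hc S)
    (fun S => hd S) (fun S T => by simpa only [inf_eq_inter, sup_eq_union] using h S T)
    (univ.filter fun S => S ∩ X = A) (univ.filter fun S => S ∩ X = B)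
  refine key.trans (mul_le_mul ?_ ?_ (sum_nonneg fun S _ => hd S) (sum_nonneg fun S _ => hc S))
  · exact sum_le_sum_of_subset_of_nonneg (fib_infs_subset X A B) fun S _ _ => hc S
  · exact sum_le_sum_of_subset_of_nonneg (fib_sups_subset X A B) fun S _ _ => hd S

section Masses

variable {μ : Finset V → K} {X : Finset V} {u v : Finset V → K}

/-- **Fibre FKG**: `fm(u) · fm(v) ≤ λ · fm(u v)` on every fibre. -/
lemma fibre_fkg (hμ0 : ∀ S, 0 ≤ μ S) (hlsm : ∀ S T, μ S * μ T ≤ μ (S ∩ T) * μ (S ∪ T))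
    (hu0 : ∀ S, 0 ≤ u S) (humono : ∀ S T, S ⊆ T → u S ≤ u T)
    (hv0 : ∀ S, 0 ≤ v S) (hvmono : ∀ S T, S ⊆ T → v S ≤ v T) (A : Finset V) :
    (∑ S ∈ univ.filter (fun S => S ∩ X = A), μ S * u S) *
        (∑ S ∈ univ.filter (fun S => S ∩ X = A), μ S * v S) ≤
      (∑ S ∈ univ.filter (fun S => S ∩ X = A), μ S) *
        (∑ S ∈ univ.filter (fun S => S ∩ X = A), μ S * (u S * v S)) := by
  have key := four_functions_fib X A A (fun S => μ S * u S) (fun S => μ S * v S) μ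
    (fun S => μ S * (u S * v S)) (fun S => mul_nonneg (hμ0 S) (hu0 S))
    (fun S => mul_nonneg (hμ0 S) (hv0 S)) hμ0
    (fun S => mul_nonneg (hμ0 S) (mul_nonneg (hu0 S) (hv0 S))) (fun S T => by
      calc μ S * u S * (μ T * v T) = (μ S * μ T) * (u S * v T) := by ring
        _ ≤ (μ (S ∩ T) * μ (S ∪ T)) * (u (S ∪ T) * v (S ∪ T)) :=
          mul_le_mul (hlsm S T)
            (mul_le_mul (humono S _ subset_union_left) (hvmono T _ subset_union_right)
              (hv0 T) (hu0 _))
            (mul_nonneg (hu0 S) (hv0 T)) (mul_nonneg (hμ0 _) (hμ0 _))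
        _ = μ (S ∩ T) * (μ (S ∪ T) * (u (S ∪ T) * v (S ∪ T))) := by ring)
  simpa only [inter_self, union_self] using key

/-- **Holley-type monotonicity of the fibre means**:
`fm(u)(A) · λ(B) ≤ λ(A ∩ B) · fm(u)(A ∪ B)`. -/
lemma fm_mul_lam_le (hμ0 : ∀ S, 0 ≤ μ S) (hlsm : ∀ S T, μ S * μ T ≤ μ (S ∩ T) * μ (S ∪ T))
    (hu0 : ∀ S, 0 ≤ u S) (humono : ∀ S T, S ⊆ T → u S ≤ u T) (A B : Finset V) :
    (∑ S ∈ univ.filter (fun S => S ∩ X = A), μ S * u S) *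
        (∑ S ∈ univ.filter (fun S => S ∩ X = B), μ S) ≤
      (∑ S ∈ univ.filter (fun S => S ∩ X = A ∩ B), μ S) *
        (∑ S ∈ univ.filter (fun S => S ∩ X = A ∪ B), μ S * u S) :=
  four_functions_fib X A B (fun S => μ S * u S) μ μ (fun S => μ S * u S)
    (fun S => mul_nonneg (hμ0 S) (hu0 S)) hμ0 hμ0
    (fun S => mul_nonneg (hμ0 S) (hu0 S)) (fun S T => by
      calc μ S * u S * μ T = (μ S * μ T) * u S := by ring
        _ ≤ (μ (S ∩ T) * μ (S ∪ T)) * u (S ∪ T) :=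
          mul_le_mul (hlsm S T) (humono S _ subset_union_left) (hu0 S)
            (mul_nonneg (hμ0 _) (hμ0 _))
        _ = μ (S ∩ T) * (μ (S ∪ T) * u (S ∪ T)) := by ring)

/-- **The marginal is log-supermodular**: `λ(A) · λ(B) ≤ λ(A ∩ B) · λ(A ∪ B)`. -/
lemma lam_lsm (hμ0 : ∀ S, 0 ≤ μ S) (hlsm : ∀ S T, μ S * μ T ≤ μ (S ∩ T) * μ (S ∪ T))
    (A B : Finset V) :
    (∑ S ∈ univ.filter (fun S => S ∩ X = A), μ S) *
        (∑ S ∈ univ.filter (fun S => S ∩ X = B), μ S) ≤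
      (∑ S ∈ univ.filter (fun S => S ∩ X = A ∩ B), μ S) *
        (∑ S ∈ univ.filter (fun S => S ∩ X = A ∪ B), μ S) :=
  four_functions_fib X A B μ μ μ μ hμ0 hμ0 hμ0 hμ0 hlsm

/-- `fm(u) ≤ λ` when `u ≤ 1`. -/
lemma fm_le_lam (hμ0 : ∀ S, 0 ≤ μ S) (hu1 : ∀ S, u S ≤ 1) (A : Finset V) :
    (∑ S ∈ univ.filter (fun S => S ∩ X = A), μ S * u S) ≤
      ∑ S ∈ univ.filter (fun S => S ∩ X = A), μ S :=
  sum_le_sum fun S _ => by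
    calc μ S * u S ≤ μ S * 1 := mul_le_mul_of_nonneg_left (hu1 S) (hμ0 S)
      _ = μ S := mul_one _

/-- The Ahlswede–Daykin condition for the marginal with the fibre means `fm/λ`
(`x / 0 = 0` takes care of the fibres of mass `0`). -/
lemma marginal_condition (hμ0 : ∀ S, 0 ≤ μ S)
    (hlsm : ∀ S T, μ S * μ T ≤ μ (S ∩ T) * μ (S ∪ T))
    (hu0 : ∀ S, 0 ≤ u S) (hu1 : ∀ S, u S ≤ 1) (humono : ∀ S T, S ⊆ T → u S ≤ u T)
    (hv0 : ∀ S, 0 ≤ v S) (hv1 : ∀ S, v S ≤ 1) (hvmono : ∀ S T, S ⊆ T → v S ≤ v T)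
    (A B : Finset V) :
    (∑ S ∈ univ.filter (fun S => S ∩ X = A), μ S * u S) *
        (∑ S ∈ univ.filter (fun S => S ∩ X = B), μ S * v S) ≤
      (∑ S ∈ univ.filter (fun S => S ∩ X = A ∩ B), μ S) *
        ((∑ S ∈ univ.filter (fun S => S ∩ X = A ∪ B), μ S * u S) *
            (∑ S ∈ univ.filter (fun S => S ∩ X = A ∪ B), μ S * v S) /
          ∑ S ∈ univ.filter (fun S => S ∩ X = A ∪ B), μ S) := by
  set lamA := ∑ S ∈ univ.filter (fun S => S ∩ X = A), μ S with hlamA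
  set lamB := ∑ S ∈ univ.filter (fun S => S ∩ X = B), μ S with hlamB
  set lamI := ∑ S ∈ univ.filter (fun S => S ∩ X = A ∩ B), μ S with hlamI
  set lamU := ∑ S ∈ univ.filter (fun S => S ∩ X = A ∪ B), μ S with hlamU
  set fuA := ∑ S ∈ univ.filter (fun S => S ∩ X = A), μ S * u S with hfuA
  set fvB := ∑ S ∈ univ.filter (fun S => S ∩ X = B), μ S * v S with hfvB
  set fuU := ∑ S ∈ univ.filter (fun S => S ∩ X = A ∪ B), μ S * u S with hfuU
  set fvU := ∑ S ∈ univ.filter (fun S => S ∩ X = A ∪ B), μ S * v S with hfvU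
  have hlamA0 : 0 ≤ lamA := sum_nonneg fun S _ => hμ0 S
  have hlamB0 : 0 ≤ lamB := sum_nonneg fun S _ => hμ0 S
  have hlamI0 : 0 ≤ lamI := sum_nonneg fun S _ => hμ0 S
  have hlamU0 : 0 ≤ lamU := sum_nonneg fun S _ => hμ0 S
  have hfuA0 : 0 ≤ fuA := sum_nonneg fun S _ => mul_nonneg (hμ0 S) (hu0 S)
  have hfvB0 : 0 ≤ fvB := sum_nonneg fun S _ => mul_nonneg (hμ0 S) (hv0 S)
  have hfuU0 : 0 ≤ fuU := sum_nonneg fun S _ => mul_nonneg (hμ0 S) (hu0 S)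
  have hfvU0 : 0 ≤ fvU := sum_nonneg fun S _ => mul_nonneg (hμ0 S) (hv0 S)
  -- the three four-functions facts
  have e1 : A ∩ (A ∪ B) = A := by ext x; simp only [mem_inter, mem_union]; tauto
  have e2 : A ∪ (A ∪ B) = A ∪ B := by ext x; simp only [mem_union]; tauto
  have e3 : B ∩ (A ∪ B) = B := by ext x; simp only [mem_inter, mem_union]; tauto
  have e4 : B ∪ (A ∪ B) = A ∪ B := by ext x; simp only [mem_union]; tauto
  have h1 : fuA * lamU ≤ lamA * fuU := by
    have := fm_mul_lam_le (X := X) hμ0 hlsm hu0 humono A (A ∪ B)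
    rw [e1, e2] at this
    exact this
  have h2 : fvB * lamU ≤ lamB * fvU := by
    have := fm_mul_lam_le (X := X) hμ0 hlsm hv0 hvmono B (A ∪ B)
    rw [e3, e4] at this
    exact this
  have h3 : lamA * lamB ≤ lamI * lamU := lam_lsm (X := X) hμ0 hlsm A B
  have hfuU_le : fuU ≤ lamU := fm_le_lam (X := X) hμ0 hu1 (A ∪ B)
  have hfvB_le : fvB ≤ lamB := fm_le_lam (X := X) hμ0 hv1 B
  rcases eq_or_lt_of_le hlamU0 with hU | hU
  · -- the join fibre has mass zero: both sides vanish
    rw [← hU, div_zero, mul_zero]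
    have hfuU' : fuU = 0 := le_antisymm (hU ▸ hfuU_le) hfuU0
    have : fuA * lamB ≤ 0 := by
      calc fuA * lamB ≤ lamI * fuU := by
            have := fm_mul_lam_le (X := X) hμ0 hlsm hu0 humono A B
            simpa only [← hlamB, ← hlamI, ← hfuA, ← hfuU] using this
        _ = 0 := by rw [hfuU', mul_zero]
    rcases eq_or_lt_of_le hfuA0 with hA | hA
    · rw [← hA, zero_mul]
    · have hB : lamB = 0 := by
        rcases eq_or_lt_of_le hlamB0 with hB | hB
        · exact hB.symm
        · exact absurd this (not_le.2 (mul_pos hA hB))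
      have : fvB = 0 := le_antisymm (hB ▸ hfvB_le) hfvB0
      rw [this, mul_zero]
  · rw [mul_div_assoc', le_div_iff₀ hU]
    have : fuA * fvB * lamU * lamU ≤ lamI * (fuU * fvU) * lamU := by
      calc fuA * fvB * lamU * lamU = (fuA * lamU) * (fvB * lamU) := by ring
        _ ≤ (lamA * fuU) * (lamB * fvU) :=
          mul_le_mul h1 h2 (mul_nonneg hfvB0 hlamU0) (mul_nonneg hlamA0 hfuU0)
        _ = (lamA * lamB) * (fuU * fvU) := by ring
        _ ≤ (lamI * lamU) * (fuU * fvU) :=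
          mul_le_mul_of_nonneg_right h3 (mul_nonneg hfuU0 hfvU0)
        _ = lamI * (fuU * fvU) * lamU := by ring
    exact le_of_mul_le_mul_right this hU

/-- **The marginal FKG inequality** for the fibre means:
`(∑_A fm(u)(A)) (∑_A fm(v)(A)) ≤ (∑_A λ(A)) (∑_A fm(u)(A) fm(v)(A) / λ(A))`. -/
lemma marginal_fkg (hμ0 : ∀ S, 0 ≤ μ S)
    (hlsm : ∀ S T, μ S * μ T ≤ μ (S ∩ T) * μ (S ∪ T))
    (hu0 : ∀ S, 0 ≤ u S) (hu1 : ∀ S, u S ≤ 1) (humono : ∀ S T, S ⊆ T → u S ≤ u T)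
    (hv0 : ∀ S, 0 ≤ v S) (hv1 : ∀ S, v S ≤ 1) (hvmono : ∀ S T, S ⊆ T → v S ≤ v T) :
    (∑ A : Finset V, ∑ S ∈ univ.filter (fun S => S ∩ X = A), μ S * u S) *
        (∑ A : Finset V, ∑ S ∈ univ.filter (fun S => S ∩ X = A), μ S * v S) ≤
      (∑ A : Finset V, ∑ S ∈ univ.filter (fun S => S ∩ X = A), μ S) *
        ∑ A : Finset V, (∑ S ∈ univ.filter (fun S => S ∩ X = A), μ S * u S) *
            (∑ S ∈ univ.filter (fun S => S ∩ X = A), μ S * v S) /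
          ∑ S ∈ univ.filter (fun S => S ∩ X = A), μ S := by
  have key := four_functions_theorem
    (fun A : Finset V => ∑ S ∈ univ.filter (fun S => S ∩ X = A), μ S * u S)
    (fun A : Finset V => ∑ S ∈ univ.filter (fun S => S ∩ X = A), μ S * v S)
    (fun A : Finset V => ∑ S ∈ univ.filter (fun S => S ∩ X = A), μ S)
    (fun A : Finset V => (∑ S ∈ univ.filter (fun S => S ∩ X = A), μ S * u S) *
        (∑ S ∈ univ.filter (fun S => S ∩ X = A), μ S * v S) /
          ∑ S ∈ univ.filter (fun S => S ∩ X = A), μ S)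
    (fun A => sum_nonneg fun S _ => mul_nonneg (hμ0 S) (hu0 S))
    (fun A => sum_nonneg fun S _ => mul_nonneg (hμ0 S) (hv0 S))
    (fun A => sum_nonneg fun S _ => hμ0 S)
    (fun A => div_nonneg (mul_nonneg (sum_nonneg fun S _ => mul_nonneg (hμ0 S) (hu0 S))
      (sum_nonneg fun S _ => mul_nonneg (hμ0 S) (hv0 S))) (sum_nonneg fun S _ => hμ0 S))
    (fun A B => by
      simpa only [inf_eq_inter, sup_eq_union] using
        marginal_condition (X := X) hμ0 hlsm hu0 hu1 humono hv0 hv1 hvmono A B)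
    univ univ
  refine key.trans (mul_le_mul ?_ ?_ (sum_nonneg fun A _ => div_nonneg
    (mul_nonneg (sum_nonneg fun S _ => mul_nonneg (hμ0 S) (hu0 S))
      (sum_nonneg fun S _ => mul_nonneg (hμ0 S) (hv0 S))) (sum_nonneg fun S _ => hμ0 S))
    (sum_nonneg fun A _ => sum_nonneg fun S _ => hμ0 S))
  · exact sum_le_sum_of_subset_of_nonneg (subset_univ _) fun A _ _ => sum_nonneg fun S _ => hμ0 S
  · exact sum_le_sum_of_subset_of_nonneg (subset_univ _) fun A _ _ => div_nonneg
      (mul_nonneg (sum_nonneg fun S _ => mul_nonneg (hμ0 S) (hu0 S))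
        (sum_nonneg fun S _ => mul_nonneg (hμ0 S) (hv0 S))) (sum_nonneg fun S _ => hμ0 S)

/-- Per fibre, `fm(u) fm(v) / λ ≤ fm(u v)` (with `x / 0 = 0`). -/
lemma fm_mul_fm_div_lam_le (hμ0 : ∀ S, 0 ≤ μ S)
    (hlsm : ∀ S T, μ S * μ T ≤ μ (S ∩ T) * μ (S ∪ T))
    (hu0 : ∀ S, 0 ≤ u S) (humono : ∀ S T, S ⊆ T → u S ≤ u T)
    (hv0 : ∀ S, 0 ≤ v S) (hvmono : ∀ S T, S ⊆ T → v S ≤ v T) (A : Finset V) :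
    (∑ S ∈ univ.filter (fun S => S ∩ X = A), μ S * u S) *
        (∑ S ∈ univ.filter (fun S => S ∩ X = A), μ S * v S) /
          ∑ S ∈ univ.filter (fun S => S ∩ X = A), μ S ≤
      ∑ S ∈ univ.filter (fun S => S ∩ X = A), μ S * (u S * v S) := by
  have hf := fibre_fkg (X := X) hμ0 hlsm hu0 humono hv0 hvmono A
  have hl : 0 ≤ ∑ S ∈ univ.filter (fun S => S ∩ X = A), μ S := sum_nonneg fun S _ => hμ0 S
  rcases eq_or_lt_of_le hl with h0 | h0
  · rw [← h0, div_zero]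
    exact sum_nonneg fun S _ => mul_nonneg (hμ0 S) (mul_nonneg (hu0 S) (hv0 S))
  · rw [div_le_iff₀ h0]
    linarith [hf]

/-- **(CR) for log-supermodular laws with an avoidance conditioning** (MINE-A.md §94.0).
For a nonnegative log-supermodular weight `μ` on the subsets of `V`, an avoided set `X`, and
monotone `u, v : Finset V → [0, 1]`, with `R = {S ∣ S ∩ X = ∅}`:
`M(1_R) · M(u) · M(v) ≤ M(1) · (M(1_R) · M(1_{Rᶜ} u v) + M(1_R u) · M(1_R v))`,
i.e. `Cov(u, v) ≥ P(R) · Cov(u, v ∣ R)` for the probability law `μ / M(1)`. -/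
theorem cr_avoid (hμ0 : ∀ S, 0 ≤ μ S)
    (hlsm : ∀ S T, μ S * μ T ≤ μ (S ∩ T) * μ (S ∪ T))
    (hu0 : ∀ S, 0 ≤ u S) (hu1 : ∀ S, u S ≤ 1) (humono : ∀ S T, S ⊆ T → u S ≤ u T)
    (hv0 : ∀ S, 0 ≤ v S) (hv1 : ∀ S, v S ≤ 1) (hvmono : ∀ S T, S ⊆ T → v S ≤ v T) :
    (∑ S ∈ univ.filter (fun S => S ∩ X = ∅), μ S) * (∑ S : Finset V, μ S * u S) *
        (∑ S : Finset V, μ S * v S) ≤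
      (∑ S : Finset V, μ S) *
        ((∑ S ∈ univ.filter (fun S => S ∩ X = ∅), μ S) *
            (∑ S ∈ univ.filter (fun S => S ∩ X ≠ ∅), μ S * (u S * v S)) +
          (∑ S ∈ univ.filter (fun S => S ∩ X = ∅), μ S * u S) *
            (∑ S ∈ univ.filter (fun S => S ∩ X = ∅), μ S * v S)) := by
  -- fibre decomposition of the total sums
  have hfib : ∀ f : Finset V → K,
      ∑ S : Finset V, f S = ∑ A : Finset V, ∑ S ∈ univ.filter (fun S => S ∩ X = A), f S :=
    fun f => (sum_fiberwise univ (fun S => S ∩ X) f).symm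
  -- the `Rᶜ` mass of `u v` as a total minus the `R` fibre
  have hcompl : (∑ S ∈ univ.filter (fun S => S ∩ X ≠ ∅), μ S * (u S * v S)) =
      (∑ A ∈ univ.erase (∅ : Finset V),
        ∑ S ∈ univ.filter (fun S => S ∩ X = A), μ S * (u S * v S)) := by
    have h1 := sum_filter_add_sum_filter_not univ (fun S : Finset V => S ∩ X = ∅)
      (fun S => μ S * (u S * v S))
    have h2 := add_sum_erase univ
      (fun A : Finset V => ∑ S ∈ univ.filter (fun S => S ∩ X = A), μ S * (u S * v S))
      (mem_univ (∅ : Finset V))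
    rw [hfib (fun S => μ S * (u S * v S))] at h1
    linarith [h1, h2]
  rw [hcompl, hfib (fun S => μ S * u S), hfib (fun S => μ S * v S), hfib μ]
  set lam : Finset V → K := fun A => ∑ S ∈ univ.filter (fun S => S ∩ X = A), μ S with hlam
  set fu : Finset V → K := fun A => ∑ S ∈ univ.filter (fun S => S ∩ X = A), μ S * u S with hfu
  set fv : Finset V → K := fun A => ∑ S ∈ univ.filter (fun S => S ∩ X = A), μ S * v S with hfv
  set fuv : Finset V → K := fun A => ∑ S ∈ univ.filter (fun S => S ∩ X = A), μ S * (u S * v S)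
    with hfuv
  have hmarg : (∑ A, fu A) * (∑ A, fv A) ≤ (∑ A, lam A) * ∑ A, fu A * fv A / lam A :=
    marginal_fkg (X := X) hμ0 hlsm hu0 hu1 humono hv0 hv1 hvmono
  have hper : ∀ A, fu A * fv A / lam A ≤ fuv A := fun A =>
    fm_mul_fm_div_lam_le (X := X) hμ0 hlsm hu0 humono hv0 hvmono A
  have hlam0 : ∀ A, 0 ≤ lam A := fun A => sum_nonneg fun S _ => hμ0 S
  have hfu0 : ∀ A, 0 ≤ fu A := fun A => sum_nonneg fun S _ => mul_nonneg (hμ0 S) (hu0 S)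
  have hfv0 : ∀ A, 0 ≤ fv A := fun A => sum_nonneg fun S _ => mul_nonneg (hμ0 S) (hv0 S)
  have hZ0 : 0 ≤ ∑ A, lam A := sum_nonneg fun A _ => hlam0 A
  have hsplit := add_sum_erase univ (fun A => fu A * fv A / lam A) (mem_univ (∅ : Finset V))
  have hsum_erase : ∑ A ∈ univ.erase (∅ : Finset V), fu A * fv A / lam A ≤
      ∑ A ∈ univ.erase (∅ : Finset V), fuv A := sum_le_sum fun A _ => hper A
  show lam ∅ * (∑ A, fu A) * (∑ A, fv A) ≤
    (∑ A, lam A) * (lam ∅ * (∑ A ∈ univ.erase (∅ : Finset V), fuv A) + fu ∅ * fv ∅)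
  rcases eq_or_lt_of_le (hlam0 ∅) with h0 | h0
  · rw [← h0, zero_mul, zero_mul, zero_mul, zero_add]
    exact mul_nonneg hZ0 (mul_nonneg (hfu0 ∅) (hfv0 ∅))
  · have hdiv : lam ∅ * (fu ∅ * fv ∅ / lam ∅) = fu ∅ * fv ∅ := by
      field_simp
    calc lam ∅ * (∑ A, fu A) * (∑ A, fv A)
        = lam ∅ * ((∑ A, fu A) * (∑ A, fv A)) := by ring
      _ ≤ lam ∅ * ((∑ A, lam A) * ∑ A, fu A * fv A / lam A) :=
          mul_le_mul_of_nonneg_left hmarg (hlam0 ∅)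
      _ = (∑ A, lam A) * (lam ∅ * (fu ∅ * fv ∅ / lam ∅) +
            lam ∅ * ∑ A ∈ univ.erase (∅ : Finset V), fu A * fv A / lam A) := by
          rw [← hsplit]; ring
      _ = (∑ A, lam A) * (lam ∅ * ∑ A ∈ univ.erase (∅ : Finset V), fu A * fv A / lam A +
            fu ∅ * fv ∅) := by rw [hdiv]; ring
      _ ≤ (∑ A, lam A) * (lam ∅ * (∑ A ∈ univ.erase (∅ : Finset V), fuv A) + fu ∅ * fv ∅) :=
          mul_le_mul_of_nonneg_left
            (by linarith [mul_le_mul_of_nonneg_left hsum_erase (hlam0 ∅)]) hZ0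

end Masses

end CRFKG

end Summit.Ventures.PercRepro2
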